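import Literature.NumberTheory.EllipticCurves.Sprung2024.ChromaticCharValueRankZero
import Literature.NumberTheory.EllipticCurves.SelmerCorankControl
import HarnessLib

/-!
# Sprung 2024, §5.2 Lemma 5.6 — the ♯/♭ SMALL CONTROL THEOREM at the bottom layer (`a_p ≠ 0`
# allowed), in the corollary form consumed by Lemma 5.7: `Sel_{p^∞}(E/ℚ)` finite ⟹ `X^⋆/XX^⋆`
# finite — named facts on the REAL objects `X^⋆(E/ℚ_∞)` of `Sprung2012/SharpFlatSelmer.lean`

Topic `Literature/NumberTheory/EllipticCurves`, cluster `Sprung2024`. Companion of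
`Sprung2024/ChromaticCharValueRankZero.lean` (`sec52_…`, `lem59_…`: §5.2's cotorsion remark and the
♯/♭ `Γ`-Euler characteristic, Lemmas 5.5 · 5.8 · 5.9) and `…AllN.lean` (`lem59AllN_…`). Source
(version of record): F. Ito Sprung, *On Iwasawa main conjectures for elliptic curves at
supersingular primes: beyond the case `a_p = 0`*, Adv. Math. **449** (2024) 109741 [Sprung2024]
(publisher PDF at the NSF Public Access Repository, purl 10611567, store `paper:url-4cf1d13002d7`;
locators `p. NN` = journal page); preprint twin arXiv:1610.10017 §4.2, Lemma 4.7. TWO published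
statements vendored as NAMED FACTS (`def … : Prop`, nothing asserted, no `_holds`; D-0014);
statements only, net debt +2. Filed by cell `bsd-ssimc`, seat `bsd-ssimc-k3c5-kdot-split` g4, in answer
to the tenure planner's want **W-KDOT-CTRL** (D24-11 (3): "a ♯/♭ control theorem at finite level for
`a_p ≠ 0` — the printed source or the honest «not in print»") for the crux-5 child K2
`SharpFlatRankZeroConverseAtThree` (stmt-BirchSwinnertonDyer-19877) of route K3 `SignedLowerHalves`.
HONEST FRAMING: nothing about any curve is asserted; no census cell moves; BSD is not proved by any
of this.

## The printed statement (§5.2, p. 41), verbatim, and the form vendored here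

p. 41: "We let `X⋆_0 = Hom(Sel⋆(E, ℚ), ℚ_p/ℤ_p)`. Note that by the discussions at the beginning of
the subsection, we have `E♯_{0,p} = E♭_{0,p} = E(ℚ_p) ⊗ ℚ_p/ℤ_p`. Let `X_0 := Hom(Sel(E, ℚ), ℚ_p/ℤ_p)`.
Then `X⋆_0 = X_0`. **Lemma 5.6. (Small Control Theorem)** The natural morphism
`X⋆/XX⋆ ⟶ X⋆_0/XX⋆_0 = X_0` is surjective and has finite kernel. *Proof.* The proof of [32, Theorem
9.3] with `n = 0` with the adjustment that `r_p` is injective (cf. Lemma 5.5) works." ([32] =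
Kobayashi 2003; `r_p` injective is the `v = p` step of Lemma 5.5, p. 40, from [64, Lemma 2.3] =
Sprung 2012 and the snake lemma.) The form in which the section CONSUMES it is the next sentence
(proof of Lemma 5.7, p. 41): "It suffices to prove that `X⋆/XX⋆` is finite. This follows from the
small control theorem (i.e. Lemma 5.6) above, which implies that `X⋆/XX⋆` is finite if and only if
`X⋆_0/XX⋆_0` is. `X⋆_0/XX⋆_0 = X_0` being finite is automatic by our assumption." Here `Sel(E, ℚ)` is
the `p^∞`-Selmer group `Sel_{p^∞}(E/ℚ) ⊂ H¹(ℚ, E[p^∞])` (top row of the diagram on p. 39; "`Sel(E,ℚ)_p`"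
in the preprint), `X` is the cyclotomic variable (`γ ↦ 1 + X`), and `X⋆ = Hom(Sel⋆(E, ℚ_∞), ℚ_p/ℤ_p)`
is the dual of the chromatic Selmer group of [64, Def. 7.11] — the tree's
`Sprung2012.SharpFlatSelmerDualData … col` with `D.X`, on which `T = PowerSeries.X` acts as `γ - 1`
(`toDual_T_smul`), so that `X⋆/XX⋆` is `IwasawaAlgebra.coinvariants p D.X`.

VENDORED FORM (corollary form, one implication of the printed "if and only if"): **`Sel_{p^∞}(E/ℚ)`
finite ⟹ `X⋆/XX⋆` finite** — a surjection with finite kernel onto the finite group `X_0` has finite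
source. The "natural morphism" itself (the Pontryagin dual of restriction
`Sel_{p^∞}(E/ℚ) → Sel⋆(E/ℚ_∞)^Γ`) is not transcribed: `TODO(general form): the morphism
X⋆/XX⋆ → X_0, its surjectivity and the finiteness of its kernel` (needs the restriction map on the
tree's `sharpFlatSelmerInfty`, cf. `Kobayashi2003.resInfty_kummerMapPInfty_mem_signedSelmerInfty` for
the `±` twin). The standing hypotheses of §5.2 are those of Thm. 5.3 (p. 38: "square-free conductor
`N`", "supersingular reduction at `p ≠ 2`", "`L(E,1) ≠ 0`", "Conjecture 3.33"); Lemma 5.6 and its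
proof use neither `L(E,1) ≠ 0` (Lemma 5.7 invokes it separately, "if `L(E,1) ≠ 0`") nor Conjecture
3.33 (used only in "Proof of Theorem 5.3" through Thm. 1.1) nor square-freeness (used once, p. 38
l. 3–4, inside the proof of Thm. 5.1 — littype-11's line check recorded in `…AllN.lean`); the proof
cited is Kobayashi's Thm. 9.3 at `n = 0` (Galois cohomology, no `L`-value, no conductor condition)
plus [64, Lemma 2.3]. Accordingly:

* `lem56_sharpFlat_finite_coinvariants_of_finite_selmer` — WITH the standing binder
  `W.IsSemistable (𝓞 ℚ)` (square-free `N`), the setting of `Sprung2012.thm22_exists_isHondaSystem`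
  (= the binders of `lem59_…` minus the `L`-value, the torsion clause and the generator), either
  colour, every dual datum `D`: `Finite (Sel_{p^∞}(E/ℚ)) → Finite (X⋆/XX⋆)`;
* `lem56AllN_sharpFlat_finite_coinvariants_of_finite_selmer` — the same WITHOUT `W.IsSemistable (𝓞 ℚ)`.
  PRINT STATUS: stronger than the section-level statement; justified by (a) the line check above and
  (b) Ray–Sprung, Ann. Inst. Fourier **75** (2025) p. 2343, which attributes Kim's formula
  "[26, Lemmas 4.4, 4.5, 4.8]" (= Lemmas 5.8, 5.5, 5.9 here) "all assuming that `F = ℚ`" with no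
  conductor condition — and Lemma 5.8 = [26, Lemma 4.4] is proved in print THROUGH Lemma 5.7/5.6
  ("taking into account Lemma 5.7", p. 41), so the attributed formula carries the small control
  theorem with it. Flag `Sprung24-§5.2-L5.6-allN-via-RaySprung25` for reviewers and consumers.
  (The one-line edge "allN ⟹ printed form" — the binder `W.IsSemistable (𝓞 ℚ)` is simply not used —
  is recorded in the consumer file, keeping this file statements-only.)

Consumer (cell bsd-ssimc): with (MC↓⋆) = `Theorems.SprungSharpFlatLowerDivisibility` for the
Rohrlich colour, Sprung 2012 Thm. 7.14 and Greenberg's Lemma 4.2 (tree theorem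
`IwasawaAlgebra.constantCoeff_charGenerator_ne_zero_of_finite_coinvariants`) this fact yields the
rank-0 `p`-converse (conv₀) on class X8 — `Theorems/SignedLowerHalvesSprungLowerHalfAtThreeSplitConverse.lean`.

References: [Sprung2024] §5.2 Lemma 5.6 and proof of Lemma 5.7 (p. 41), Lemma 5.5 (p. 40), Thm. 5.3
(p. 38); arXiv:1610.10017 Lemma 4.7 (p. 16); [Kobayashi2003] Thm. 9.3 and Prop. 9.2;
[Sprung2012] Lemma 2.3, Def. 7.11; [RaySprung2025] p. 2343; [GreenbergLNM1716] Lemma 4.2.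
Design: statements only (two `def … : Prop`), `namespace Literature.NumberTheory.EllipticCurves.Sprung2024`;
no instance, no notation; binder order = `lem59_…` minus the `L`-value, torsion and generator binders.
-/

noncomputable section

open scoped Classical NumberField

open NumberField IsDedekindDomain WeierstrassCurve Literature.NumberTheory.EllipticCurves
  Literature.NumberTheory.EllipticCurves.ZpExtension Literature.NumberTheory.EllipticCurves.Sprung2017
  Literature.NumberTheory.EllipticCurves.Sprung2012

namespace Literature.NumberTheory.EllipticCurves.Sprung2024

/-- **Sprung 2024, Lemma 5.6 (Small Control Theorem), corollary form, under §5.2's standing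
square-free hypothesis.** Printed (p. 41): "The natural morphism `X⋆/XX⋆ ⟶ X⋆_0/XX⋆_0 = X_0` is
surjective and has finite kernel", `X_0 := Hom(Sel(E, ℚ), ℚ_p/ℤ_p)`, whence (proof of Lemma 5.7)
"`X⋆/XX⋆` is finite if and only if `X⋆_0/XX⋆_0` is". Vendored: for `W/ℚ` with square-free conductor
(`W.IsSemistable (𝓞 ℚ)`), `p ≠ 2` of good supersingular reduction (`p ∣ a_p`), in the setting of
`Sprung2012.thm22_exists_isHondaSystem` (cyclotomic `(κ, γ)`, place `v ∣ p`, local lift `g`, Honda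
system `(cneg, c)`), for either colour `⋆` and every dual datum `D` of `Sel⋆(E/ℚ_∞)`:
`Sel_{p^∞}(E/ℚ)` finite ⟹ `X⋆/XX⋆ = D.X/T·D.X` (`IwasawaAlgebra.coinvariants p D.X`) finite. One
implication of the printed control statement; the morphism itself is `TODO(general form)`. Nothing is
asserted; no `_holds` is expected.
[cite: Sprung2024, §5.2 Lemma 5.6 and proof of Lemma 5.7 (p. 41)] [cite: Kobayashi2003, Thm. 9.3] -/
def lem56_sharpFlat_finite_coinvariants_of_finite_selmer : Prop :=
  ∀ (W : WeierstrassCurve ℚ) [W.IsElliptic] [W.IsGloballyMinimal] (p : ℕ) [Fact p.Prime],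
    p ≠ 2 → W.IsSemistable (𝓞 ℚ) → W.HasGoodReductionAtPrime p → (p : ℤ) ∣ W.frobeniusTrace p →
    ∀ (κ : ZpExtension ℚ p) (γ : Field.absoluteGaloisGroup ℚ),
      κ.IsCyclotomic → κ.IsTopGenerator γ → IsCyclotomicVariable p γ →
    ∀ (v : HeightOneSpectrum (𝓞 ℚ)), (p : 𝓞 ℚ) ∈ v.asIdeal →
    ∀ (g : Field.absoluteGaloisGroup (v.adicCompletion ℚ)),
      κ.IsTopGenerator (resGalOfEmb (closureEmb (K := ℚ) (v.adicCompletion ℚ)) g) →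
    ∀ (cneg : localPoints W (v.adicCompletion ℚ)) (c : ℕ → localPoints W (v.adicCompletion ℚ)),
      IsHondaSystem κ (closureEmb (K := ℚ) (v.adicCompletion ℚ)) W (W.frobeniusTrace p) g cneg c →
    ∀ (col : Chroma)
      (D : SharpFlatSelmerDualData W κ γ (closureEmb (K := ℚ) (v.adicCompletion ℚ))
        (W.frobeniusTrace p) g c col),
      Finite (W.selmerGroupPInfty p) → Finite (IwasawaAlgebra.coinvariants p D.X)

/-- **Sprung 2024, Lemma 5.6 (Small Control Theorem), corollary form, for every conductor.** The body
of `lem56_sharpFlat_finite_coinvariants_of_finite_selmer` WITHOUT the binder `W.IsSemistable (𝓞 ℚ)`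
(§5.2's standing "square-free conductor", which the printed proof — Kobayashi's Thm. 9.3 at `n = 0`
plus [64, Lemma 2.3] — does not use; Ray–Sprung, Ann. Inst. Fourier 75 (2025) p. 2343, attribute the
resulting Euler-characteristic formula "[26, Lemmas 4.4, 4.5, 4.8]", proved in print through this
lemma, "all assuming that `F = ℚ`" with no conductor condition): `p ≠ 2` good supersingular
(`p ∣ a_p`), the setting of `Sprung2012.thm22_exists_isHondaSystem`, either colour, every dual datum
`D`: `Sel_{p^∞}(E/ℚ)` finite ⟹ `X⋆/XX⋆` finite. PRINT STATUS: stronger than the section-level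
statement of [Sprung2024]; flag `Sprung24-§5.2-L5.6-allN-via-RaySprung25` (module docstring).
Nothing is asserted; no `_holds` is expected.
[cite: Sprung2024, §5.2 Lemma 5.6 and proof of Lemma 5.7 (p. 41)]
[cite: RaySprung2025, p. 2343 (§1.2, the sentence on Sel♯/Sel♭ and [26, Lemmas 4.4, 4.5, 4.8])]
[cite: Kobayashi2003, Thm. 9.3] -/
def lem56AllN_sharpFlat_finite_coinvariants_of_finite_selmer : Prop :=
  ∀ (W : WeierstrassCurve ℚ) [W.IsElliptic] [W.IsGloballyMinimal] (p : ℕ) [Fact p.Prime],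
    p ≠ 2 → W.HasGoodReductionAtPrime p → (p : ℤ) ∣ W.frobeniusTrace p →
    ∀ (κ : ZpExtension ℚ p) (γ : Field.absoluteGaloisGroup ℚ),
      κ.IsCyclotomic → κ.IsTopGenerator γ → IsCyclotomicVariable p γ →
    ∀ (v : HeightOneSpectrum (𝓞 ℚ)), (p : 𝓞 ℚ) ∈ v.asIdeal →
    ∀ (g : Field.absoluteGaloisGroup (v.adicCompletion ℚ)),
      κ.IsTopGenerator (resGalOfEmb (closureEmb (K := ℚ) (v.adicCompletion ℚ)) g) →
    ∀ (cneg : localPoints W (v.adicCompletion ℚ)) (c : ℕ → localPoints W (v.adicCompletion ℚ)),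
      IsHondaSystem κ (closureEmb (K := ℚ) (v.adicCompletion ℚ)) W (W.frobeniusTrace p) g cneg c →
    ∀ (col : Chroma)
      (D : SharpFlatSelmerDualData W κ γ (closureEmb (K := ℚ) (v.adicCompletion ℚ))
        (W.frobeniusTrace p) g c col),
      Finite (W.selmerGroupPInfty p) → Finite (IwasawaAlgebra.coinvariants p D.X)

end Literature.NumberTheory.EllipticCurves.Sprung2024

/-! ### APPEND (cell `bsd-ssimc`, seat `bsd-ssimc-k3-c5` g9, 2026-08-27): the OTHER implication of the
printed small control theorem, in the same corollary form — `X⋆/XX⋆` finite ⟹ `Sel_{p^∞}(E/ℚ)` finite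

The two `def`s above vendor the implication «`Sel_{p^∞}(E/ℚ)` finite ⟹ `X⋆/XX⋆` finite» (finite kernel
onto a finite target). The printed statement — Lemma 5.6 (p. 41) = arXiv:1610.10017 Lemma 4.7 [p0016
L17–L18]: "The natural morphism `X⋆/XX⋆ ⟶ X⋆_0/XX⋆_0 = X_0` is SURJECTIVE and has finite kernel",
with `X_0 := Hom(Sel(E, ℚ), ℚ_p/ℤ_p)` and, as consumed in the proof of Lemma 5.7 (p. 41) = arXiv
Lemma 4.6 [p0016 L14]: "`X⋆/XX⋆` is finite IF AND ONLY IF `X⋆_0/XX⋆_0` is" — also gives the converse: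
a SURJECTION from a finite group has a finite target, and `X_0 = Hom(Sel_{p^∞}(E/ℚ), ℚ_p/ℤ_p)` is
finite iff the discrete torsion group `Sel_{p^∞}(E/ℚ)` is (Pontryagin duality). This is the half that
the RANK-POSITIVE consumers need (cell bsd-ssimc, crux child K1 of route `SignedLowerHalves` at
analytic rank one: `rank E(ℚ) ≥ 1 ⇒ Sel_{p^∞}(E/ℚ)` infinite ⇒ `X⋆/XX⋆` infinite ⇒ `T ∣ char(X⋆)` by
Greenberg's Lemma 4.2), with the same binders, the same printed-scope / all-conductor split and the same
flag as the pair above; statements only (two `def … : Prop`, nothing asserted, no `_holds`; debt +2).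
-/

namespace Literature.NumberTheory.EllipticCurves.Sprung2024

/-- **Sprung 2024, Lemma 5.6 (Small Control Theorem), SURJECTIVITY half in corollary form, under §5.2's
standing square-free hypothesis.** Printed (p. 41; arXiv:1610.10017 Lemma 4.7): "The natural morphism
`X⋆/XX⋆ ⟶ X⋆_0/XX⋆_0 = X_0` is surjective and has finite kernel", `X_0 := Hom(Sel(E, ℚ), ℚ_p/ℤ_p)`,
whence (proof of Lemma 5.7 = arXiv Lemma 4.6) "`X⋆/XX⋆` is finite if and only if `X⋆_0/XX⋆_0` is".
Vendored (the «only if» half): for `W/ℚ` with square-free conductor (`W.IsSemistable (𝓞 ℚ)`), `p ≠ 2`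
of good supersingular reduction (`p ∣ a_p`), in the setting of `Sprung2012.thm22_exists_isHondaSystem`
(cyclotomic `(κ, γ)`, place `v ∣ p`, local lift `g`, Honda system `(cneg, c)`), for either colour `⋆`
and every dual datum `D` of `Sel⋆(E/ℚ_∞)`: `X⋆/XX⋆ = D.X/T·D.X` (`IwasawaAlgebra.coinvariants p D.X`)
finite ⟹ `Sel_{p^∞}(E/ℚ)` (`W.selmerGroupPInfty p`) finite — the surjection onto `X_0` makes `X_0`
finite, and a discrete `p`-primary torsion group with finite Pontryagin dual is finite. Companion of
`lem56_sharpFlat_finite_coinvariants_of_finite_selmer` (the «if» half); the morphism itself stays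
`TODO(general form)`. Nothing is asserted; no `_holds` is expected.
[cite: Sprung2024, §5.2 Lemma 5.6 and proof of Lemma 5.7 (p. 41)] [cite: Kobayashi2003, Thm. 9.3] -/
def lem56_sharpFlat_finite_selmer_of_finite_coinvariants : Prop :=
  ∀ (W : WeierstrassCurve ℚ) [W.IsElliptic] [W.IsGloballyMinimal] (p : ℕ) [Fact p.Prime],
    p ≠ 2 → W.IsSemistable (𝓞 ℚ) → W.HasGoodReductionAtPrime p → (p : ℤ) ∣ W.frobeniusTrace p →
    ∀ (κ : ZpExtension ℚ p) (γ : Field.absoluteGaloisGroup ℚ),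
      κ.IsCyclotomic → κ.IsTopGenerator γ → IsCyclotomicVariable p γ →
    ∀ (v : HeightOneSpectrum (𝓞 ℚ)), (p : 𝓞 ℚ) ∈ v.asIdeal →
    ∀ (g : Field.absoluteGaloisGroup (v.adicCompletion ℚ)),
      κ.IsTopGenerator (resGalOfEmb (closureEmb (K := ℚ) (v.adicCompletion ℚ)) g) →
    ∀ (cneg : localPoints W (v.adicCompletion ℚ)) (c : ℕ → localPoints W (v.adicCompletion ℚ)),
      IsHondaSystem κ (closureEmb (K := ℚ) (v.adicCompletion ℚ)) W (W.frobeniusTrace p) g cneg c →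
    ∀ (col : Chroma)
      (D : SharpFlatSelmerDualData W κ γ (closureEmb (K := ℚ) (v.adicCompletion ℚ))
        (W.frobeniusTrace p) g c col),
      Finite (IwasawaAlgebra.coinvariants p D.X) → Finite (W.selmerGroupPInfty p)

/-- **Sprung 2024, Lemma 5.6 (Small Control Theorem), SURJECTIVITY half in corollary form, for every
conductor.** The body of `lem56_sharpFlat_finite_selmer_of_finite_coinvariants` WITHOUT the binder
`W.IsSemistable (𝓞 ℚ)` (§5.2's standing "square-free conductor", not used by the printed proof —
Kobayashi's Thm. 9.3 at `n = 0` plus [64, Lemma 2.3]; Ray–Sprung, Ann. Inst. Fourier 75 (2025) p. 2343,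
attribute the Euler-characteristic formula proved THROUGH this lemma "all assuming that `F = ℚ`" with
no conductor condition): `p ≠ 2` good supersingular (`p ∣ a_p`), the setting of
`Sprung2012.thm22_exists_isHondaSystem`, either colour, every dual datum `D`: `X⋆/XX⋆` finite ⟹
`Sel_{p^∞}(E/ℚ)` finite. PRINT STATUS: stronger than the section-level statement of [Sprung2024]; flag
`Sprung24-§5.2-L5.6-allN-via-RaySprung25` (module docstring), exactly as for
`lem56AllN_sharpFlat_finite_coinvariants_of_finite_selmer`. Nothing is asserted; no `_holds` is expected.
[cite: Sprung2024, §5.2 Lemma 5.6 and proof of Lemma 5.7 (p. 41)]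
[cite: RaySprung2025, p. 2343 (§1.2, the sentence on Sel♯/Sel♭ and [26, Lemmas 4.4, 4.5, 4.8])]
[cite: Kobayashi2003, Thm. 9.3] -/
def lem56AllN_sharpFlat_finite_selmer_of_finite_coinvariants : Prop :=
  ∀ (W : WeierstrassCurve ℚ) [W.IsElliptic] [W.IsGloballyMinimal] (p : ℕ) [Fact p.Prime],
    p ≠ 2 → W.HasGoodReductionAtPrime p → (p : ℤ) ∣ W.frobeniusTrace p →
    ∀ (κ : ZpExtension ℚ p) (γ : Field.absoluteGaloisGroup ℚ),
      κ.IsCyclotomic → κ.IsTopGenerator γ → IsCyclotomicVariable p γ →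
    ∀ (v : HeightOneSpectrum (𝓞 ℚ)), (p : 𝓞 ℚ) ∈ v.asIdeal →
    ∀ (g : Field.absoluteGaloisGroup (v.adicCompletion ℚ)),
      κ.IsTopGenerator (resGalOfEmb (closureEmb (K := ℚ) (v.adicCompletion ℚ)) g) →
    ∀ (cneg : localPoints W (v.adicCompletion ℚ)) (c : ℕ → localPoints W (v.adicCompletion ℚ)),
      IsHondaSystem κ (closureEmb (K := ℚ) (v.adicCompletion ℚ)) W (W.frobeniusTrace p) g cneg c →
    ∀ (col : Chroma)
      (D : SharpFlatSelmerDualData W κ γ (closureEmb (K := ℚ) (v.adicCompletion ℚ))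
        (W.frobeniusTrace p) g c col),
      Finite (IwasawaAlgebra.coinvariants p D.X) → Finite (W.selmerGroupPInfty p)

end Literature.NumberTheory.EllipticCurves.Sprung2024

end
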